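import Summits.BirchSwinnertonDyer.BirchSwinnertonDyer.Theorems.KolyvaginDepthDoorKolyvaginDepthSupplyLeafReciprocity
import Summits.BirchSwinnertonDyer.BirchSwinnertonDyer.Theorems.KolyvaginDepthDoorKolyvaginDepthSupplyZhangGrossPow
import HarnessLib

/-!
# Route `KolyvaginDepthDoor`, crux `KolyvaginDepthSupply` (stmt-BirchSwinnertonDyer-21765) —
# LEAF 5 OF THE hF-FREE DOOR DISCHARGED AT EVERY LEVEL: `McCallum1991.prop22_reciprocity_eigen_finset`
# (McCallum 1991 Prop. 2.2 with Lemma 5.3 at a finite set of Kolyvagin places, level `p^M`) HOLDS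

Helper file (`--supports stmt-BirchSwinnertonDyer-21765 --as helper`); it closes nothing and BSD is
not proved by it.

The named leaf `Literature.NumberTheory.EllipticCurves.McCallum1991.prop22_reciprocity_eigen_finset`
(file `McCallum1991/KolyvaginClassesLocalLeaves`, recorded "Size M (local Tate duality, reciprocity for
`Br K`); no `_holds`") is proved here at EVERY level `p^M`, unconditionally, by composing:

* `kolyvaginReciprocityFinset_of_poitouTate_of_hasGoodReductionAt` (`…LeafReciprocityOfPoitouTate`:
  Kolyvagin's reciprocity (R)_M at `λ` against Selmer classes vanishing at finitely many further
  places, from Poitou–Tate — x11b3's proof re-bound) with the tree THEOREM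
  `poitouTate_sum_localTatePairing_eq_zero_holds` (cell `bsd-cn100`);
* the Gross-cluster theorem `lemma_5_3_descent_of_reciprocity` (McCallum's Lemma 5.3 with Prop. 2.2,
  level `p^M`, everything but the reciprocity law PROVED);
* the bridge `frobEqFrobInfty_pow_of_zhang` (`…ZhangGrossPow`, this seat): W. Zhang's Kolyvagin primes
  of index `≥ M` satisfy Gross's (3.2) modulo `p^M` under the leaf's tower surjectivity;
* good reduction at `ℓ ∤ N_E` over `ℚ` (`LocalFrob.hasGoodReductionAt_rat_of_not_dvd_conductorNorm`),
  base-changed to `K` (`hasGoodReductionAt_baseChange_of_hasGoodReductionAt_rat`).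

* `prop22_reciprocity_eigen_finset_holds` — **the leaf HOLDS** (its `¬ CM` binder is idle).

Together with `sign_conjAct_kolyvaginClass_holds` (`…LeafSign`) two of the five McCallum leaves of the
route are now theorems AS STATED; nothing is asserted about any curve; BSD is not proved by it.

References: [McCallumLMS1991] §2 Prop. 2.2 (p. 297), §4 (p. 299), §5 Lemma 5.3 (p. 304), proof of
Prop. 5.2 (p. 306); [GrossLMS1991] §3 (3.2)–(3.3), §8 Prop. 8.2; [MilneADT2006] Ch. I Thm. 4.10 (b);
[WZhang2014] Notations (xii).
-/

set_option linter.dupNamespace false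

noncomputable section

open scoped Classical Pointwise

namespace Summit.BirchSwinnertonDyer.BirchSwinnertonDyer.Theorems.KolyvaginDepthDoor

open WeierstrassCurve NumberField IsDedekindDomain Field
open Literature.NumberTheory.EllipticCurves Literature.NumberTheory.EllipticCurves.ModularForms
open Literature.NumberTheory.EllipticCurves.McCallum1991
open Literature.NumberTheory.GaloisRepresentations Literature.NumberTheory.GaloisCohomology
open Summit.BirchSwinnertonDyer.Rank1Residual.X11b.Three.Koly.Method2

/-- **LEAF 5 DISCHARGED: `McCallum1991.prop22_reciprocity_eigen_finset` HOLDS** (McCallum 1991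
Prop. 2.2 *"`∑_v inv_v(c_v ∪ c'_v) = 0`"* used as in the proof of Prop. 5.2 and read at `λ` through
Lemma 5.3, at every level `p^M`: for a finite set `T` of Zhang–Kolyvagin primes of index `≥ M`,
`ℓ ∈ T`, a `ν`-eigenclass `d ∈ H¹(K, E[p^M])` Selmer off the places of `T` and at infinity, and
`s ∈ Sel_{p^M}(E/K)^ν` vanishing at the places of `T ∖ {ℓ}`: `ord(s_λ)·ord(d_λ) ≤ p^M`, i.e.
`p^a d_λ ≠ 0 ⟹ p^{M−1−a} s_λ = 0`). Proof: module docstring. Unconditional.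
[cite: McCallumLMS1991, §2 Prop. 2.2, §5 Lemma 5.3, proof of Prop. 5.2 (p. 306)]
[cite: GrossLMS1991, §3 (3.2), §8 Prop. 8.2] [cite: MilneADT2006, Ch. I Thm. 4.10(b)] -/
theorem prop22_reciprocity_eigen_finset_holds : prop22_reciprocity_eigen_finset := by
  intro W _ _ _ _hcm K _ _ hK p _ hp2 htower c hc M hM T hT ℓ hℓT ν hν d hd hdfin hdinf s hs hτs hsT v
    hv a ha hdv
  have hp : p.Prime := Fact.out
  by_contra hsv
  -- Zhang ⟹ Gross at every prime of `T`, at level `p^M`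
  have hρ : W.HasSurjectiveModNGaloisRep p := by simpa only [pow_one] using htower 1
  have hG : ∀ r ∈ T, IsKolyvaginPrime (W.conductorNorm ℤ) W K p r := fun r hr ↦
    Summit.BirchSwinnertonDyer.Rank1Residual.JET.ZhangGross.isKolyvaginPrime_of_zhang W K hK hp2 hρ
      (hT r hr).1
  have hℓG : IsKolyvaginPrime (W.conductorNorm ℤ) W K p ℓ := hG ℓ hℓT
  have hfrob : FrobEqFrobInfty W K (p ^ M) ℓ :=
    frobEqFrobInfty_pow_of_zhang W K hK hp2 hM (htower M) (hT ℓ hℓT).1 (hT ℓ hℓT).2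
  have hveq : v = hℓG.place := hℓG.mem_iff.mp hv
  subst hveq
  -- good reduction of `E/K` at `λ`: `ℓ ∤ N_E`
  have hgood : (W.baseChange K).HasGoodReductionAt hℓG.place := by
    haveI : hℓG.place.asIdeal.LiesOver (hℓG.place.under (𝓞 ℚ)).asIdeal := ⟨rfl⟩
    exact hasGoodReductionAt_baseChange_of_hasGoodReductionAt_rat W (hℓG.place.under (𝓞 ℚ))
      hℓG.place (LocalFrob.hasGoodReductionAt_rat_of_not_dvd_conductorNorm W hℓG.prime hℓG.2.1 _
        hℓG.natCast_mem_under)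
  -- (R)_M against `s` vanishing on the places of `T ∖ {ℓ}`, from the Poitou–Tate theorem
  obtain ⟨A, _, eA, halt, hnd, hR⟩ :=
    kolyvaginReciprocityFinset_of_poitouTate_of_hasGoodReductionAt (W.conductorNorm ℤ) W K
      (poitouTate_sum_localTatePairing_eq_zero_holds K) hp hM hℓG hgood
  let T' : Finset (HeightOneSpectrum (𝓞 K)) :=
    (T.erase ℓ).attach.image fun r ↦ (hG r.1 (Finset.mem_of_mem_erase r.2)).place
  have hsT' : ∀ v' ∈ T', s ∈ (W.baseChange K).torsionLocalKer (v'.adicCompletion K)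
      ((p ^ M : ℕ) : ℤ) := by
    intro v' hv'
    obtain ⟨r, -, rfl⟩ := Finset.mem_image.mp hv'
    obtain ⟨hrℓ, hrT⟩ := Finset.mem_erase.mp r.2
    exact hsT r.1 hrT hrℓ _ (hG r.1 hrT).mem_place
  have hdfin' : ∀ v' : HeightOneSpectrum (𝓞 K), v' ∉ T' → (ℓ : 𝓞 K) ∉ v'.asIdeal →
      d ∈ selmerLocalKer (W.baseChange K) (v'.adicCompletion K) ((p ^ M : ℕ) : ℤ) := by
    intro v' hv'T hℓv'
    refine hdfin v' fun r hr hrv' ↦ ?_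
    by_cases hrℓ : r = ℓ
    · exact hℓv' (hrℓ ▸ hrv')
    · apply hv'T
      have hv'eq : v' = (hG r hr).place := (hG r hr).mem_iff.mp hrv'
      exact Finset.mem_image.mpr ⟨⟨r, Finset.mem_erase.mpr ⟨hrℓ, hr⟩⟩, Finset.mem_attach _ _,
        hv'eq.symm⟩
  have hRd := hR T' s hs hsT' d hdfin' hdinf
  -- McCallum's Lemma 5.3 with Prop. 2.2 at level `p^M`
  have hdv' : ((p : ℤ) ^ a) • d ∉
      selmerLocalKer (W.baseChange K) (hℓG.place.adicCompletion K) ((p ^ M : ℕ) : ℤ) := by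
    rw [← Nat.cast_pow]; exact hdv
  have h53 := lemma_5_3_descent_of_reciprocity W hK hp hp2 hc hℓG hM (q := p ^ M) rfl hfrob hgood eA
    halt hnd hν hd hdv' hs hτs hRd
  rw [← Nat.cast_pow] at h53
  exact hsv h53

end Summit.BirchSwinnertonDyer.BirchSwinnertonDyer.Theorems.KolyvaginDepthDoor

end
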